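import Mathlib.NumberTheory.NumberField.Completion.FinitePlace
import Literature.NumberTheory.Automorphic.AdicCompletionLocalField
import Literature.NumberTheory.GaloisRepresentations.AdicCompletionUniformizer
import Literature.NumberTheory.GaloisRepresentations.LocalGlobalCohomologyFiniteProofs
import Summits.ABC.IUTFork.LanaKummerInjective
import Summits.ABC.IUTFork.LanaKummerTowerInjective
import HarnessLib

/-!
# L-LANA objects XII bis′: the Kummer embedding `K_v^× ↪ H¹(G_v, Λ)` is injective at EVERY finite place of a number field (LANA §4.2 (b)) — PROVED

Proof-only companion (theorems, no definitions) of `LanaKummerInjective.lean` (seat abc-iut-c312-4, L-LANA level,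
plan/LLANA-SPEC N9/N13); TAKES NO SIDE on [IUTchIII] Cor. 3.12. LANA's places `v ∈ V` are places of a number field
(§1.1, §4.2), `K_v` the completion. `LanaKummerInjective.lean` proved injectivity of the Kummer map
`K_v^× = (K̄_v^×)^{G_v} → H¹(G_v, Λ(K̄_v^×))` under the presentation-free condition `⋂_n (K_v^×)^n = 1`
(`DivisibleElementsTrivial K_vˣ`) and discharged it at `ℚ_p`. HERE it is discharged at every completion
`K_v = v.adicCompletion K` of a number field `K` at a finite place `v`: the tree knows `K_v` is a nonarchimedean
local field in Mathlib's sense (`Literature.NumberTheory.Automorphic.AdicCompletionLocalField`, instance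
`instIsNonarchimedeanLocalFieldAdicCompletion`), so seat abc-iut-L4's
`IsNonarchimedeanLocalField.divisibleElementsTrivial_units` gives `⋂_n (K_v^×)^n = 1`, and `K_v` carries the
normed-field structure of Mathlib's `Valued.toNontriviallyNormedField` (the tree's reducible
`Ultrametric.AdicCompletion.nontriviallyNormedField`, GalRep trunk) over the SAME field structure, so gen-0's
`AlgCl K_v`, `kummerBase K_v` make sense and `kummerBase_injective_of` applies verbatim:

* `AlgCl.adicCompletion_divisibleElementsTrivial` — `⋂_n (K_v^×)^n = 1`;
* `AlgCl.adicCompletion_kummerBase_injective`, `adicCompletion_kummerEmbedding_injective`,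
  `adicCompletion_kummerEmbedding_eq_zero_iff` — **LANA §4.2 (b) "the embedding … by Kummer theory" is an
  embedding, unconditionally, at every finite place of every number field.**

[cite: LANA2026Report, §4.2 (b) p. 26, §6.1 p. 31] [cite: MochizukiAbsTopIII2015, Rmk 1.5.4 (i) p. 33]
NOT here: archimedean places; any judgement.
-/

noncomputable section

namespace Summit.ABC
namespace IUTFork
namespace AlgCl

open NumberField IsDedekindDomain
open Literature.AnabelianGeometry.AbsoluteAnabelian.AbsTopIII (DivisibleElementsTrivial)

-- `K_v` as a nontrivially normed field (Mathlib `Valued.toNontriviallyNormedField`; the tree's reducible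
-- definition, whose `NormedField` part is Mathlib's registered instance) and `char K_v = 0` (tree theorem),
-- both as LOCAL instances so that `AlgCl K_v` / `kummerBase K_v` elaborate.
attribute [local instance] Literature.NumberTheory.GaloisRepresentations.Ultrametric.AdicCompletion.nontriviallyNormedField
attribute [local instance] Literature.NumberTheory.GaloisRepresentations.charZero_adicCompletion

variable (K : Type) [Field K] [NumberField K] (v : HeightOneSpectrum (𝓞 K))

/-- **`⋂_n (K_v^×)^n = 1`** at a finite place `v` of a number field `K`: `K_v` is a nonarchimedean local field
(tree instance) and [AbsTopIII] Def. 1.5 (a) holds for `𝔾_m` over such fields (seat abc-iut-L4,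
`IsNonarchimedeanLocalField.divisibleElementsTrivial_units`). [cite: MochizukiAbsTopIII2015, Rmk 1.5.4 (i) p. 33] -/
theorem adicCompletion_divisibleElementsTrivial : DivisibleElementsTrivial (v.adicCompletion K)ˣ :=
  Literature.AnabelianGeometry.AbsoluteAnabelian.AbsTopIII.IsNonarchimedeanLocalField.divisibleElementsTrivial_units
    (v.adicCompletion K)

/-- **LANA §4.2 (b) at every finite place of a number field, UNCONDITIONALLY**: the Kummer map
`(K̄_v^×)^{G_v} → H¹(G_v, Λ(K̄_v^×))` is injective. [cite: LANA2026Report, §4.2 (b) p. 26] -/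
theorem adicCompletion_kummerBase_injective : Function.Injective (kummerBase (v.adicCompletion K)) :=
  kummerBase_injective_of (v.adicCompletion K) (adicCompletion_divisibleElementsTrivial K v)

/-- … and so is the embedding `K_v^× ↪ H¹(G_v, Λ(K̄_v^×))`. [cite: LANA2026Report, §4.2 (b) p. 26] -/
theorem adicCompletion_kummerEmbedding_injective : Function.Injective (kummerEmbedding (v.adicCompletion K)) :=
  kummerEmbedding_injective_of (v.adicCompletion K) (adicCompletion_divisibleElementsTrivial K v)

/-- At a finite place: `κ(x) = 0 ⟺ x = 1` for every `x ∈ K_v^×` — the Kummer class detects every nontrivial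
element. [cite: LANA2026Report, §4.2 (b) p. 26] -/
theorem adicCompletion_kummerEmbedding_eq_zero_iff (x : (v.adicCompletion K)ˣ) :
    kummerEmbedding (v.adicCompletion K) (Additive.ofMul x) = 0 ↔ x = 1 :=
  kummerEmbedding_eq_zero_iff_of (v.adicCompletion K) (adicCompletion_divisibleElementsTrivial K v) x

/-! ### Appendix (gen 2, second filing): the whole Kummer tower at a finite place -/

/-- **`K_v` is torally Kummer-faithful** at every finite place of a number field ([AbsTopIII] Rmk. 1.5.4 (i):
a nonarchimedean local field of characteristic `0`; seat abc-iut-L4's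
`isTorallyKummerFaithful_of_isNonarchimedeanLocalField` applied to the tree instance for `v.adicCompletion K`).
[cite: MochizukiAbsTopIII2015, Rmk 1.5.4 (i) p. 33] -/
theorem adicCompletion_isTorallyKummerFaithful :
    Literature.AnabelianGeometry.AbsoluteAnabelian.AbsTopIII.IsTorallyKummerFaithful (v.adicCompletion K) :=
  Literature.AnabelianGeometry.AbsoluteAnabelian.AbsTopIII.isTorallyKummerFaithful_of_isNonarchimedeanLocalField
    (v.adicCompletion K)

/-- **At every finite place of a number field, UNCONDITIONALLY: `κ : K̄_v^× → lim_{→ H} H¹(H, Λ(K̄_v^×))` is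
injective on all of `K̄_v^×`** (`LanaKummerTowerInjective.kummerTower_injective_of` + the previous theorem).
[cite: LANA2026Report, §6.1 pp. 31–32] -/
theorem adicCompletion_kummerTower_injective : Function.Injective (kummerTower (v.adicCompletion K)) :=
  kummerTower_injective_of (v.adicCompletion K) (adicCompletion_isTorallyKummerFaithful K v)

/-- `κ(a) = 0 ⟺ a = 1` for every `a ∈ K̄_v^×` at a finite place. [cite: LANA2026Report, §6.1 p. 31] -/
theorem adicCompletion_kummerTower_eq_zero_iff (a : (AlgCl (v.adicCompletion K))ˣ) :
    kummerTower (v.adicCompletion K) (Additive.ofMul a) = 0 ↔ a = 1 :=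
  kummerTower_eq_zero_iff_of (v.adicCompletion K) (adicCompletion_isTorallyKummerFaithful K v) a

end AlgCl

end IUTFork

end Summit.ABC

end
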